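import Literature.Claims.NS.ClayVariants
import Literature.Claims.NS.ClayPeriodScalingBridge
import Literature.Analysis.FluidPDE.TaoAveragedEuler
import Mathlib.Combinatorics.Enumerative.Catalan.Basic
import Mathlib.Analysis.Calculus.IteratedDeriv.Defs
import HarnessLib

/-!
# Claim skeleton C35 — Vasquez Campos 2024, «On the Existence and Smoothness of the Navier-Stokes Equation I»

**Cite header.** Brian David Vasquez Campos (Khalifa University), *On the Existence and Smoothness of
the Navier-Stokes Equation I*, arXiv:2405.07929 [math.AP]; TEXT OF RECORD = **v3** (18 Jun 2024; one
TeX file `Navier_Stokes_Vasquez.tex`, 3100 lines; `l.` below = v3 TeX line numbers, «v4 l.» = the v4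
TeX of 6 Dec 2024), cell ruling ns-claims-lead-1 2026-08-26T17:27:06Z; bib key `VasquezCampos2024`.
UNREFEREED CLAIM under adjudication (D-0090 NS-claims sweep, cell `ns-claims`, row C35) — this file
TYPES the claimed statement and the paper's own intermediate assertions as `Prop`s and asserts none of
them; the only theorems are compositions by pure logic (`smallData_of_steps`, `claim_of_steps`,
`clay_of_claimed`, `claimedV4_of_steps`). Nothing here is a theorem about Navier–Stokes.
Printed pages `p.` = pages of the v3 PDF (= printed page numbers; `sources/VasquezCampos2024/arXiv-PDFs/`,
PAGEMAP by ns-claims-lit-1 g4); printed item numbers (Prop. 8, Thm. 11, Cor. 20–24, Thm. 12, Def. 6) are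
those of the v3 PDF, TeX labels in backticks.
[cite: VasquezCampos2024, Introduction l.501 p.2; §2 l.641–733 pp.4–5; §6 l.2003–2423 pp.23–29]

**Claimed statement (as printed).** v3 has no numbered main theorem; the claim is the sentence of the
Introduction, l.501 (p.2): «In this paper, we focus on the homogeneous case, assuming the initial velocity is
Schwartz, and provide a positive resolution to Navier-Stokes problem (A) as proposed in [Clay] for any
dimension `d ≥ 3`», with the setting of §2 l.643–658 (NS on `ℝ^d × [0,∞)`, `ν > 0`, `f ≡ 0`,
`u⁰ ∈ S(ℝ^d)^d`, solution `(u,p) ∈ C^∞(ℝ^{d+1}_+)` with `sup_{t ≥ 0} ∫ |u|² < ∞`) and the Conclusions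
l.2886–2888 (p.36) «we proved the existence and smoothness of a solution of the Navier-Stokes Equation for
viscosity large enough» composed with §2 «Reduction of the Problem to Special Viscosities». Typed at
`d = 3` as `ClaimedTheorem` — token for token the body of Clay (A) in the schema of
`Literature.Claims.NS.ClayVariants` (`clay_of_claimed` is the identity).
-- TODO(general form): the paper states `d ≥ 3`; only the Clay case `d = 3` is typed.

**Clay delta.** NONE on the face of the v3 claim: Δ1 domain `ℝ³` =, Δ2 NS with constant `ν > 0` =,
Δ3 `f ≡ 0` =, Δ4 data Schwartz = Clay (4) (`ContDiff ℝ ∞ ∧ HasRapidSpatialDecay`), Δ5 solution class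
`C^∞(ℝ³ × [0,∞))` + bounded energy = (6)(7), Δ6 =, Δ7 «every `ν > 0`» via the §2 reduction. The v4
restatement (v4 Thm. 1, l.553–557) adds a smallness hypothesis `‖|·|^{(d+1)/2} û⁰‖_{1⊕2} < Cν` with a
HOMOGENEOUS weight (`ClaimedTheoremV4`); on its face a Δ4 restriction, in substance not (the hypothesis
is met by an NS-rescaling `u⁰ ↦ λu⁰(λ·)`, `λ → 0`, of every Schwartz datum — see `ClaimedTheoremV4`).

**Architecture of the printed proof and ORDERED STEP INDEX** (order = the order the argument uses the
assertions; print order for the §2 joint, dependency order inside §6). `C` = the paper's «universal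
constant» of §3–§4 (Remark l.921–923: «a constant depending of the order of the involved Lebesgue spaces
and the dimension»), never computed in print; every Step that mentions it takes it as a parameter.
* Step 1 = `Reduction` — §2 l.660–733 (pp.4–5): «there is a solution for `ν > 0` if and only if there is a
  solution for `αν > 0` for every `α > 0`» via `v(x,t) = u(x/α, t/α)`, `q(x,t) = p(x/α, t/α)`,
  `v⁰(x) = u⁰(x/α)`; used in the direction l.715–733 (solve at viscosity `αν` with datum `u⁰(·/α)`,
  scale back by `u(x,t) = v(αx, αt)`) — PROVED in-file, `reduction_holds` (revision: Leray's rescaling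
  `isNavierStokesSolution_nsRescale_zero` + `ClaySpec.Solvable.of_viscosity`, bounded energy kept).
* Step 2 = `GlueThreshold C` — IMPLICIT, asserted by l.713 (p.5) «Since `v⁰ ∈ S(ℝ^d)^d` if `u ∈ S(ℝ^d)^d` it
  is enough to solve the Navier-Stokes Equation for an arbitrary or sufficiently large viscosity
  `ν > 0`» read against the only place where «large enough» is pinned, the proof of Cor. `vfastdecrease`
  (= Cor. 23, p.27) l.2301–2306: «converges … if and only if `ν > (2C/π) ‖v⁰_{0,(d+1)/2}‖_{1⊕2}` independently on `m` and
  `n`», `v⁰_{0,α}(ξ) = max{1,|ξ|}^α |û⁰(ξ)|` (l.2061): for every datum `u⁰` and every `ν > 0` SOME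
  rescaling `α > 0` must put `(αν, u⁰(·/α))` above the threshold. This is the step the composition
  needs and the paper does not print (BREAKS-AT-LOGIC candidate; the typist's located joint). Its
  ABSTRACT GRAIN (HYGIENE 13 companion) is `CompositionRule` — the inference rule «threshold existence per
  datum + scaling equivalence ⇒ all (datum, ν)» over an arbitrary (datum, viscosity)-predicate, def text =
  the referee scaffold of ns-claims-ref-3 g2 (`retype-VasquezCampos2024.lean`, REF PRE-READ 00:45:28Z),
  consumed by the alternative composition `claim_of_steps_abs`.
* Step 3 = `Majorants C` — Prop. `family` (= Prop. 8, pp.23–24) l.2032–2101 + Thm. `boundmonomial`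
  (= Thm. 11, p.25) l.2106–2150 + the Corollary l.2178–2207 (= Cor. 20, p.26) / Cor. `norma1,q` (= Cor. 21,
  p.26) l.2209–2251: the Fourier-side Picard iterates `v_k`
  (l.2005–2010: `v₀ = e^{−λt|ξ|²} û⁰`, `v_k = Σ_{j<k} v_j ⊙ v_{k−1−j}`, p.23; `λ = 4π²ν`; `⊙` = Def. l.1606–1613 = Def. 6 p.17)
  admit pointwise «Fourier caloric» majorants `|(λ^{1/2}|ξ|)^m ∂ⁿ_t v_k(ξ,t)| ≤ c_k (λ(k+1)²)^{m/2+n}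
  (2πν)^{−k} e^{−λt|ξ|²/2^k} v⁰_{k,m,n}(ξ)` whose `L^{1⊕2}` norms obey the Cor. `norma1,q` bounds
  (feeds Step 4; typed standalone, not consumed by `claim_of_steps`).
* Step 4 = `IterateBounds C` — Cor. `norma1,2,infinite` (= Cor. 22, p.27) l.2254–2272 (at `d = 3`, `(d+1)/2 = 2`): the
  time-uniform weighted `L¹ ⊕ L²` bounds on `∂ⁿ_t v_k`.
* Step 5 = `SeriesConvergence C` — Cor. `vfastdecrease` (= Cor. 23, p.27) l.2279–2316 with its threshold
  l.2306 (p.27): under the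
  Step-4 bounds and `ν > (2C/π)‖v⁰_{0,2}‖_{1⊕2}`, `v = Σ_k v_k` converges in `C^∞([0,∞), 𝓔_𝓑)` and
  `v = v₀ + v ⊙ v`.
* Step 6 = `FixedPointIsSolution` — Thm. `pressure` (= Thm. 12, p.28) l.2322–2362 + the final Corollary
  (= Cor. 24, pp.28–29) l.2364–2423:
  `u(x,t) = ∫ v(ξ,t) e^{−2πi x·ξ} dξ`, `p` = l.2368 ⇒ `(u,p)` is a smooth bounded-energy NS solution
  with datum `u⁰`.
* `SmallData C` (derived, `smallData_of_steps`): Steps 4 ∧ 5 ∧ 6 ⇒ «`ν > (2C/π)‖v⁰_{0,2}‖_{1⊕2}` ⇒ a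
  Clay-sense solution» — what §6 delivers (a small-data statement; cf. v4 §8 l.2888 ff.).
COMPOSITION: proved as `claim_of_steps : Reduction → GlueThreshold C → IterateBounds C →
SeriesConvergence C → FixedPointIsSolution → ClaimedTheorem` (pure logic), and in the abstract-grain form
`claim_of_steps_abs : Reduction → CompositionRule → IterateBounds C → SeriesConvergence C →
FixedPointIsSolution → ClaimedTheorem`. The composition goes through ONLY via the implicit Step 2
(either grain); without it, Steps 1, 3–6 give `SmallData C`, not `ClaimedTheorem`
(locator of the missing implication: l.713 p.5 ↔ l.2306 p.27, the rescaled datum's threshold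
`(2C/π)‖max{1,|ξ|}² · α³û⁰(αξ)‖_{L¹⊕L²}` grows like `α^{3/2}‖û⁰‖_{L²}` while the available viscosity
is `αν`). Secondary (v4, not the text of record): `claimedV4_of_steps : GlueV4 C C' → SmallData C' →
ClaimedTheoremV4` isolates the v4 analogue (`GlueV4`: homogeneous smallness ⇒ inhomogeneous threshold).

**Typing conventions.** `ξ`-side objects are functions `ξ ↦ t ↦ ℂ³` (`FSide`). The paper does not fix
the sign convention of `^`; `hat u₀ := 𝓕⁻(u₀)` (componentwise complexified) is the one for which the
final Corollary's formula l.2367 `u(x,t) = ∫ v(ξ,t)e^{−2πix·ξ}dξ = 𝓕(v(·,t))(x)` inverts it — all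
weighted norms are insensitive to the choice. Norms `‖·‖_{1⊕2}` (l.520–527) are `eLpNorm · 1 + eLpNorm · 2`
in `ℝ≥0∞` (no junk) or their `toReal` where the print compares with a real threshold (finite on the typed
data class, Schwartz). The tensor convolution applied to `ξ` is typed with the transpose pairing of
l.2402 (`v(ξ−η) (v(η)ᵀ ξ)`); l.1511 writes `g^*` — immaterial for Steps 3–5 (moduli only). Time
derivatives on `[0,∞)` are `iteratedDerivWithin n · (Ici 0)`. Catalan numbers: the recurrence l.2024–2027
(= Mathlib `catalan`); the closed form l.2016 is off by one index (not load-bearing). `K(ξ)` = the tree's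
`leraySymbolC` (`I − ξ⊗ξ/|ξ|²`, l.2350). No `sorry`, no `axiom`, no `instance`, no notation.

WHAT THIS IS NOT: not a claim about NS regularity or blow-up; not a claim about any author beyond the
typed locator.
-/

open Set MeasureTheory FourierTransform
open Literature.Analysis.FluidPDE Literature.Claims.NS.ClayVariants
open scoped ContDiff ENNReal NNReal

namespace Literature.Claims.NS.VasquezCampos2024

noncomputable section

/-! ## Carriers and the Fourier-side vocabulary of §5–§6 (d = 3) -/

/-- Physical space `ℝ³`. [folklore] -/
abbrev R3 : Type := EuclideanSpace ℝ (Fin 3)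

/-- Frequency-side values `ℂ³`. [folklore] -/
abbrev C3 : Type := EuclideanSpace ℂ (Fin 3)

/-- A Fourier-side, time-dependent field `ξ ↦ t ↦ v(ξ,t) ∈ ℂ³` (the `v`, `v_k`, `f ⊙ g` of §5–§6,
functions on `ℝ^{d+1}_+ = ℝ^d × [0,∞)`, l.517). [cite: VasquezCampos2024, §5 Def. l.1468–1481] -/
abbrev FSide : Type := R3 → ℝ → C3

/-- The printed data class (§2 l.657–658 «`u⁰ ∈ S(ℝ^d)^d`», divergence-free l.647): smooth,
divergence-free, rapidly decaying with all derivatives — i.e. Clay (4) on top of `C^∞` and `div = 0`.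
[cite: VasquezCampos2024, §2 l.643–658 p.4] -/
def IsDatum (u₀ : R3 → R3) : Prop :=
  ContDiff ℝ ∞ u₀ ∧ NSWave0.IsDivFree u₀ ∧ HasRapidSpatialDecay u₀

/-- `û⁰` — the Fourier transform of the datum, componentwise over `ℂ`, in the convention inverted by
the final Corollary's formula l.2367 (`u(x,0) = ∫ û⁰(ξ) e^{−2πi x·ξ} dξ`, i.e. `û⁰ = 𝓕⁻ u⁰` in Mathlib's
normalisation). [cite: VasquezCampos2024, §6 l.2008 p.23; Cor. 24 l.2364–2368 p.28] -/
def hat (u₀ : R3 → R3) : R3 → C3 :=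
  𝓕⁻ (Literature.Analysis.FunctionSpaces.EuclideanSpace.complexify ∘ u₀)

/-- `λ = 4π²ν` («With our convention `λ = 4π²ν`», l.2012). [cite: VasquezCampos2024, §6 l.2012 p.23] -/
def lam (ν : ℝ) : ℝ := 4 * Real.pi ^ 2 * ν

/-- `v₀(ξ,t) = e^{−λt|ξ|²} û⁰(ξ)` (l.2008). [cite: VasquezCampos2024, §6 l.2008 p.23] -/
def vZero (ν : ℝ) (u₀ : R3 → R3) : FSide :=
  fun ξ t => ((Real.exp (-(lam ν) * t * ‖ξ‖ ^ 2) : ℝ) : ℂ) • hat u₀ ξ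

/-- The tensor convolution applied to `ξ`: `((f ∗ g)(ξ,s)) ξ = ∫ f(ξ−η,s) (g(η,s)ᵀ ξ) dη`
(Def. l.1546–1552 with the pairing as used in l.2398–2406). Bochner integral (junk `0` off `L¹`).
[cite: VasquezCampos2024, §5 Def. l.1546–1552 p.16; Cor. 24 proof l.2398–2406 p.29] -/
def tconvApply (f g : FSide) (ξ : R3) (s : ℝ) : C3 :=
  ∫ η, (∑ i, g η s i * (ξ i : ℂ)) • f (ξ - η) s

/-- The product `⊙` (Def. l.1606–1613):
`(f ⊙ g)(ξ,t) = 2πi K(ξ) [∫₀ᵗ e^{−4π²ν(t−s)|ξ|²} (f ∗ g)(ξ,s) ds] ξ`, `K(ξ) = I − ξ⊗ξ/|ξ|²` (l.2350,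
the tree's `leraySymbolC`, junk `K(0) = I`). [cite: VasquezCampos2024, §5 Def. 6 l.1606–1613 p.17] -/
def odot (ν : ℝ) (f g : FSide) : FSide :=
  fun ξ t => ((2 * Real.pi : ℝ) : ℂ) • Complex.I •
    leraySymbolC ξ (∫ s in (0 : ℝ)..t,
      ((Real.exp (-(lam ν) * (t - s) * ‖ξ‖ ^ 2) : ℝ) : ℂ) • tconvApply f g ξ s)

/-- The ITERATE SEQUENCE of §6 (l.2005–2010): `v 0 = v₀` and `v_k = Σ_{j=0}^{k−1} v_j ⊙ v_{k−1−j}` for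
`k ≥ 1` (typed as a predicate on `v : ℕ → FSide`; the recursion determines `v` uniquely).
[cite: VasquezCampos2024, §6 l.2005–2010 p.23] -/
def IsIterateSeq (ν : ℝ) (u₀ : R3 → R3) (v : ℕ → FSide) : Prop :=
  v 0 = vZero ν u₀ ∧
    ∀ k : ℕ, v (k + 1) = fun ξ t => ∑ j ∈ Finset.range (k + 1), odot ν (v j) (v (k - j)) ξ t

/-- The weight `v⁰_{0,s}(ξ) = max{1,|ξ|}^s |û⁰(ξ)|` (l.2058, l.2061: INHOMOGENEOUS weight).
[cite: VasquezCampos2024, Prop. 8 (`family`) proof l.2058–2062 p.24] -/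
def weightFn (s : ℝ) (u₀ : R3 → R3) : R3 → ℝ :=
  fun ξ => max 1 ‖ξ‖ ^ s * ‖hat u₀ ξ‖

/-- `‖v⁰_{0,s}‖_{1⊕2} = ‖v⁰_{0,s}‖_{L¹} + ‖v⁰_{0,s}‖_{L²}` (norm `1⊕2`, l.520–527; `𝓑 = L^{1⊕2}`, l.2274),
as a real number (`toReal`; finite on the typed data class). [cite: VasquezCampos2024, §1 l.520–527 p.3; §6 l.2274 p.27] -/
def normW (s : ℝ) (u₀ : R3 → R3) : ℝ :=
  (eLpNorm (weightFn s u₀) 1 volume).toReal + (eLpNorm (weightFn s u₀) 2 volume).toReal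

/-- The viscosity THRESHOLD of Cor. `vfastdecrease` at `d = 3`: `(2C/π) ‖v⁰_{0,(d+1)/2}‖_{1⊕2}` with
`(d+1)/2 = 2` («if and only if `ν > (2C/π)‖v⁰_{0,(d+1)/2}‖_{1⊕2}` independently on `m` and `n`»).
[cite: VasquezCampos2024, Cor. 23 (`vfastdecrease`) proof l.2301–2306 p.27] -/
def threshold (C : ℝ) (u₀ : R3 → R3) : ℝ :=
  2 * C / Real.pi * normW 2 u₀

/-- The weighted slice of an iterate entering Cor. `norma1,2,infinite`:
`ξ ↦ (λ^{1/2}|ξ|)^m |∂ⁿ_t w(ξ,t)|` (time derivatives within `[0,∞)`).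
[cite: VasquezCampos2024, Cor. 22 (`norma1,2,infinite`) l.2254–2267 p.27] -/
def wslice (ν : ℝ) (m n : ℕ) (w : FSide) (t : ℝ) : R3 → ℝ :=
  fun ξ => (Real.sqrt (lam ν) * ‖ξ‖) ^ m * ‖iteratedDerivWithin n (w ξ) (Ici 0) t‖

/-- `‖·‖_{1⊕2}` of a real slice, in `ℝ≥0∞` (no junk). [cite: VasquezCampos2024, §1 l.520–527 p.3] -/
def eNorm12 (g : R3 → ℝ) : ℝ≥0∞ :=
  eLpNorm g 1 volume + eLpNorm g 2 volume

/-- The right-hand side of Cor. `norma1,2,infinite` at `d = 3` (l.2256–2266):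
`c_k (λ(k+1)²)^{m/2+n} (2πν)^{−k} C^{k+2} · ‖v⁰_{0,m+2n+2}‖^{k+1}_{1⊕2}` if `k ≤ m+2n`, and
`… · ‖v⁰_{0,m+2n+2}‖^{m+2n}_{1⊕2} ‖v⁰_{0,2}‖^{k+1−m−2n}_{1⊕2}` if `k ≥ m+2n+1`; `c_k` = Catalan
(recurrence l.2024–2027 p.23). [cite: VasquezCampos2024, Cor. 22 (`norma1,2,infinite`) l.2254–2267 p.27] -/
def iterRHS (C ν : ℝ) (u₀ : R3 → R3) (k m n : ℕ) : ℝ :=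
  (catalan k : ℝ) * (lam ν * ((k : ℝ) + 1) ^ 2) ^ ((m : ℝ) / 2 + n) / (2 * Real.pi * ν) ^ k *
    C ^ (k + 2) *
    (if k ≤ m + 2 * n then normW ((m : ℝ) + 2 * n + 2) u₀ ^ (k + 1)
     else normW ((m : ℝ) + 2 * n + 2) u₀ ^ (m + 2 * n) * normW 2 u₀ ^ (k + 1 - (m + 2 * n)))

/-- The Step-4 bounds FOR a given iterate sequence: for all `k m n` and `t ≥ 0`,
`‖(λ^{1/2}|·|)^m ∂ⁿ_t v_k(·,t)‖_{1⊕2} ≤ iterRHS` (the `sup` over `t` of l.2257 written as `∀ t ≥ 0`).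
[cite: VasquezCampos2024, Cor. 22 (`norma1,2,infinite`) l.2254–2267 p.27] -/
def IterateBoundsFor (C ν : ℝ) (u₀ : R3 → R3) (v : ℕ → FSide) : Prop :=
  ∀ k m n : ℕ, ∀ t : ℝ, 0 ≤ t →
    eNorm12 (wslice ν m n (v k) t) ≤ ENNReal.ofReal (iterRHS C ν u₀ k m n)

/-- «`v ∈ C^∞([0,∞), 𝓔_𝓑)`» (Cor. `vfastdecrease` l.2280; `𝓔_𝓑` l.2274–2277 with `𝓑 = L^{1⊕2}(ℝ^d,ℂ^d)`):
each frequency slice is `C^∞` on `[0,∞)` and every weighted time derivative has `‖·‖_{1⊕2}` bounded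
uniformly in `t ≥ 0` (the paper's «`|(λ^{1/2}|·|)^m ∂ⁿ_t v| ∈ L^{1⊕2}(ℝ^{d+1}_+)` for every `m,n`»,
l.2375–2378; polynomial weights `(1+|ξ|²)^n` of `𝓔_𝓑` and `|ξ|^m` generate the same family).
[cite: VasquezCampos2024, Cor. 23 (`vfastdecrease`) l.2279–2287 p.27; Cor. 24 proof l.2374–2378 p.28] -/
def WeightedSmooth (ν : ℝ) (w : FSide) : Prop :=
  (∀ ξ, ContDiffOn ℝ ∞ (w ξ) (Ici 0)) ∧
    ∀ m n : ℕ, ∃ B : ℝ≥0∞, B < ⊤ ∧ ∀ t : ℝ, 0 ≤ t → eNorm12 (wslice ν m n w t) ≤ B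

/-- The mild (fixed-point) equation on the Fourier side: `w = v₀ + w ⊙ w` (Cor. `vfastdecrease`,
«`v = v₀ + v^{⊙2}`», l.2283–2285). [cite: VasquezCampos2024, Cor. 23 (`vfastdecrease`) l.2279–2287 p.27] -/
def IsFixedPoint (ν : ℝ) (u₀ : R3 → R3) (w : FSide) : Prop :=
  ∀ ξ t, 0 ≤ t → w ξ t = vZero ν u₀ ξ t + odot ν w w ξ t

/-! ## The claimed statement -/

/-- **The claimed theorem (v3, as printed, at `d = 3`)**: for every `ν > 0` and every smooth,
divergence-free, rapidly decaying datum `u⁰` on `ℝ³` there is a smooth solution `(u,p)` of the unforced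
Navier–Stokes system on `ℝ³ × [0,∞)` with `u(·,0) = u⁰` and `sup_{t ≥ 0} ∫ |u|² < ∞` — «a positive
resolution to Navier-Stokes problem (A) … for any dimension `d ≥ 3`» (Introduction l.501; setting §2
l.643–658; Conclusions l.2886–2888). Token for token `ClayVariants.clayR3.Regularity` unfolded.
-- TODO(general form): `d ≥ 3` in print; `d = 3` typed.
[cite: VasquezCampos2024, Introduction l.501 p.2; §2 l.643–658 p.4; Conclusions l.2886–2888 p.36] -/
def ClaimedTheorem : Prop :=
  ∀ ν : ℝ, 0 < ν → ∀ u₀ : R3 → R3, ContDiff ℝ ∞ u₀ → NSWave0.IsDivFree u₀ →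
    HasRapidSpatialDecay u₀ → clayR3.Solvable ν 0 u₀

/-- **v4 Theorem 1 as printed** (the author's restatement, v4 l.553–557, NOT the text of record):
«Take `ν > 0` and `d ≥ 3`. Let `u⁰ ∈ S(ℝ^d)^d` be any divergence-free vector field such that
`‖|·|^{(d+1)/2} û⁰‖_{1⊕2} < Cν` for `C > 0` a universal constant. Take `f ≡ 0`. Then there exists smooth
`(u,p) ∈ C^∞(ℝ^{d+1}_+)` that satisfy (1), (2), (3) and (4) [bounded energy]», at `d = 3`. NOTE the
HOMOGENEOUS weight `|ξ|^{(d+1)/2}` in the hypothesis, whereas the proof's threshold (v4 l.2177–2180, =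
v3 l.2058–2062 / l.2306) carries `max{1,|ξ|}^{(d+1)/2}`: under the NS scaling `u⁰ ↦ λu⁰(λ·)` (`ν`
fixed) the printed hypothesis tends to `0` as `λ → 0` (`L¹` part `∝ λ³`, `L²` part `∝ λ^{3/2}`), so the
statement as printed is met by a rescaling of every Schwartz datum and is of (A)-strength in substance;
the v4-internal joint is `GlueV4`. [cite: VasquezCampos2024, v4 Thm. 1 l.553–557 (v4 p.2)] -/
def ClaimedTheoremV4 : Prop :=
  ∃ C : ℝ, 0 < C ∧ ∀ ν : ℝ, 0 < ν → ∀ u₀ : R3 → R3, IsDatum u₀ →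
    (eLpNorm (fun ξ => ‖ξ‖ ^ (2 : ℝ) * ‖hat u₀ ξ‖) 1 volume).toReal +
        (eLpNorm (fun ξ => ‖ξ‖ ^ (2 : ℝ) * ‖hat u₀ ξ‖) 2 volume).toReal < C * ν →
      clayR3.Solvable ν 0 u₀

/-! ## The steps (none asserted) -/

/-- **Step 1 — the §2 reduction** (l.660–733), in the direction used (l.715–733): if the Navier–Stokes
problem with viscosity `αν` and datum `v⁰(x) = u⁰(x/α)` has a smooth bounded-energy solution `(v,q)`,
then `u(x,t) = v(αx, αt)`, `p(x,t) = q(αx, αt)` is one with viscosity `ν` and datum `u⁰` («we set the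
initial condition to be `u⁰(x) = v⁰(αx)` then the solution … is given by `u(x,t) = v(αx, αt)`»).
Typed as the transfer of Clay-sense solvability. [cite: VasquezCampos2024, §2 l.660–733 pp.4–5] -/
def Reduction : Prop :=
  ∀ ν α : ℝ, 0 < ν → 0 < α → ∀ u₀ : R3 → R3, IsDatum u₀ →
    clayR3.Solvable (α * ν) 0 (fun x => u₀ (α⁻¹ • x)) → clayR3.Solvable ν 0 u₀

/-- **Step 2 — the IMPLICIT glue between §2 and §6** (asserted by l.713 «it is enough to solve the
Navier-Stokes Equation for an arbitrary or sufficiently large viscosity `ν > 0`», where «large enough» is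
pinned only at l.2306 «`ν > (2C/π)‖v⁰_{0,(d+1)/2}‖_{1⊕2}`»): for every datum `u⁰` and every `ν > 0`
some rescaling parameter `α > 0` puts the rescaled problem `(αν, u⁰(·/α))` above the threshold of
Cor. `vfastdecrease`. Not printed; this is exactly what `claim_of_steps` consumes to pass from
`SmallData C` to `ClaimedTheorem`. (Scaling bookkeeping for the refuter: `hat (u⁰(·/α)) (ξ) = α³ û⁰(αξ)`
by `Literature.Analysis.Fourier.fourierInv_comp_smul`, so `normW 2 (u⁰(·/α)) ≥ ‖û⁰‖_{L¹} + α^{3/2}‖û⁰‖_{L²}`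
by `max{1,·} ≥ 1` and `eLpNorm_comp_smul`.)
[cite: VasquezCampos2024, §2 l.713 p.5 with Cor. 23 (`vfastdecrease`) proof l.2301–2306 p.27] -/
def GlueThreshold (C : ℝ) : Prop :=
  ∀ ν : ℝ, 0 < ν → ∀ u₀ : R3 → R3, IsDatum u₀ →
    ∃ α : ℝ, 0 < α ∧ threshold C (fun x => u₀ (α⁻¹ • x)) < α * ν

/-- **Step 2 at the ABSTRACT GRAIN (HYGIENE 13 companion of `GlueThreshold`)** — the «sufficiently large
viscosity» composition rule of l.713 (p.5) over an arbitrary type of data `W`, a rescaling action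
`scale α` on data, and a (datum, viscosity)-predicate `P`: «for every datum, `P` holds for all
sufficiently large viscosities» and the scaling equivalence «`P w ν ↔ P (scale α w) (αν)`» (what §2
l.641–716 proves for NS, pp.4–5) are asserted to give «`P` for every datum and every `ν > 0`». Def text =
the referee scaffold `CompositionRule` of ns-claims-ref-3 g2 (`HOME/ns-claims-ref-3/retype-VasquezCampos2024.lean`,
REF PRE-READ 2026-08-27T00:45:28Z), pasted verbatim; the paper instantiates it with `W` = Schwartz
divergence-free data, `scale α w = w(·/α)`, `P w ν` = «NS with viscosity `ν` and datum `w` has a smooth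
bounded-energy solution» (`claim_of_steps_abs`). The «arbitrary [fixed] viscosity» branch of the same
sentence is the valid special case `ν₀` constant. [cite: VasquezCampos2024, §2 l.713 p.5] -/
def CompositionRule : Prop :=
  ∀ (W : Type) (scale : ℝ → W → W) (P : W → ℝ → Prop),
    (∀ w : W, ∃ ν₀ : ℝ, ∀ ν : ℝ, ν₀ < ν → P w ν) →
    (∀ (w : W) (ν α : ℝ), 0 < α → (P w ν ↔ P (scale α w) (α * ν))) →
    ∀ (w : W) (ν : ℝ), 0 < ν → P w ν

/-- **Step 3 — pointwise Fourier-caloric majorants with `1⊕2` control** (Prop. `family` l.2032–2101,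
Thm. `boundmonomial` l.2106–2150, Corollary l.2178–2207, Cor. `norma1,q` l.2209–2251, at `d = 3`,
`q = 2`): for every iterate sequence there are nonnegative functions `V k m n : ℝ³ → ℝ` (the printed
`v⁰_{k,m,n} ∈ 𝒟₁`, built in print by the recursion `v⁰_{k,m,n} = max_j (v_j ⊙ v_{k−1−j})⁰_{m,n}` and
bounded by Riesz-convolution monomials in the `v⁰_{0,l}`) with the pointwise bound
`|(λ^{1/2}|ξ|)^m ∂ⁿ_t v_k(ξ,t)| ≤ c_k (λ(k+1)²)^{m/2+n} (2πν)^{−k} e^{−λt|ξ|²/2^k} V_{k,m,n}(ξ)` (l.2034–2037)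
and the norm bound `‖V_{k,m,n}‖_{1⊕2} ≤ C^{k+2} ‖v⁰_{0,m+2n+2}‖^{k+1}_{1⊕2}` (`k ≤ m+2n`), resp.
`≤ C^{k+2} ‖v⁰_{0,m+2n+2}‖^{m+2n}_{1⊕2} ‖v⁰_{0,2}‖^{k+1−m−2n}_{1⊕2}` (`k ≥ m+2n+1`) (l.2211–2219; the
print's right-hand norms are `1⊕p⊕p'` with `p = p' = 2`). Feeds Step 4 («We use the family of
inequalities of Proposition `family` and Corollary `norma1,q`», l.2270); typed standalone.
[cite: VasquezCampos2024, Prop. 8 (`family`) l.2032–2041 pp.23–24; Thm. 11 (`boundmonomial`) l.2106–2113 p.25; Cor. 21 (`norma1,q`) l.2209–2220 p.26] -/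
def Majorants (C : ℝ) : Prop :=
  ∀ ν : ℝ, 0 < ν → ∀ u₀ : R3 → R3, IsDatum u₀ → ∀ v : ℕ → FSide, IsIterateSeq ν u₀ v →
    ∃ V : ℕ → ℕ → ℕ → R3 → ℝ,
      (∀ (k m n : ℕ) (ξ : R3), 0 ≤ V k m n ξ) ∧
      (∀ (k m n : ℕ) (ξ : R3), ∀ t : ℝ, 0 ≤ t →
        (Real.sqrt (lam ν) * ‖ξ‖) ^ m * ‖iteratedDerivWithin n (v k ξ) (Ici 0) t‖ ≤
          (catalan k : ℝ) * (lam ν * ((k : ℝ) + 1) ^ 2) ^ ((m : ℝ) / 2 + n) / (2 * Real.pi * ν) ^ k *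
            Real.exp (-(lam ν) * t / 2 ^ k * ‖ξ‖ ^ 2) * V k m n ξ) ∧
      (∀ k m n : ℕ,
        eNorm12 (V k m n) ≤ ENNReal.ofReal (C ^ (k + 2) *
          (if k ≤ m + 2 * n then normW ((m : ℝ) + 2 * n + 2) u₀ ^ (k + 1)
           else normW ((m : ℝ) + 2 * n + 2) u₀ ^ (m + 2 * n) * normW 2 u₀ ^ (k + 1 - (m + 2 * n)))))

/-- **Step 4 — Cor. `norma1,2,infinite`** (l.2254–2272, `d = 3`): for every `ν > 0`, datum `u⁰` and
iterate sequence `(v_k)`, `‖(λ^{1/2}|·|)^m ∂ⁿ_t v_k‖_{1⊕2,∞} ≤ c_k (λ(k+1)²)^{m/2+n} (2πν)^{−k} C^{k+2} ×`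
`‖v⁰_{0,m+2n+2}‖^{k+1}_{1⊕2}` (`0 ≤ k ≤ m+2n`), resp. `× ‖v⁰_{0,m+2n+2}‖^{m+2n}_{1⊕2} ‖v⁰_{0,2}‖^{k+1−m−2n}_{1⊕2}`
(`k ≥ m+2n+1`). [cite: VasquezCampos2024, Cor. 22 (`norma1,2,infinite`) l.2254–2267 p.27] -/
def IterateBounds (C : ℝ) : Prop :=
  ∀ ν : ℝ, 0 < ν → ∀ u₀ : R3 → R3, IsDatum u₀ → ∀ v : ℕ → FSide, IsIterateSeq ν u₀ v →
    IterateBoundsFor C ν u₀ v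

/-- **Step 5 — Cor. `vfastdecrease`** (l.2279–2316) with the threshold of its proof (l.2306): «There
exists `v ∈ C^∞([0,∞), 𝓔_𝓑)` such that `v = v₀ + v^{⊙2}`, for `ν` large enough» — proof: «Let us
consider `v = Σ_k v_k`. By Corollary `norma1,2,infinite` … converges after applying the Ratio test …
if and only if `ν > (2C/π)‖v⁰_{0,(d+1)/2}‖_{1⊕2}` independently on `m` and `n`» and the resummation
l.2309–2315. Typed as: the Step-4 bounds for the iterates and `threshold C u⁰ < ν` give a limit
`v = Σ v_k` (pointwise sums) that is weighted-smooth and solves the fixed-point equation.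
[cite: VasquezCampos2024, Cor. 23 (`vfastdecrease`) l.2279–2316 p.27] -/
def SeriesConvergence (C : ℝ) : Prop :=
  ∀ ν : ℝ, 0 < ν → ∀ u₀ : R3 → R3, IsDatum u₀ →
    (∀ v : ℕ → FSide, IsIterateSeq ν u₀ v → IterateBoundsFor C ν u₀ v) →
    threshold C u₀ < ν →
      ∃ (v : ℕ → FSide) (w : FSide), IsIterateSeq ν u₀ v ∧
        (∀ ξ, ∀ t : ℝ, 0 ≤ t → HasSum (fun k => v k ξ t) (w ξ t)) ∧
        WeightedSmooth ν w ∧ IsFixedPoint ν u₀ w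

/-- **Step 6 — Thm. `pressure` + the final Corollary** (l.2322–2423): if `v` solves `v = v₀ + v ⊙ v`
with all weighted norms finite, then `q(ξ,t) = 2πi ((ξ⊗ξ/|ξ⊗ξ|)(v∗v)(ξ,t)ξ)`,
`u(x,t) = ∫ v(ξ,t)e^{−2πix·ξ}dξ`, `p(x,t) = −(2πi)^{−1}∫ ξᵀq(ξ,t)|ξ|^{−2} e^{−2πix·ξ}dξ` define
`(u,p) ∈ C^∞(ℝ^{d+1}_+)` with `∂ₜu + (∂ₓu)u = νΔu − ∇p`, `div u = 0`, `u(x,0) = u⁰(x)` and bounded energy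
(Plancherel, l.2417–2421) — «then `(u,p)` is the solution of the Navier-Stokes Equation». Typed with the
conclusion as Clay-sense solvability (what the composition consumes).
[cite: VasquezCampos2024, Thm. 12 (`pressure`) l.2322–2331 p.28; Cor. 24 l.2364–2423 pp.28–29] -/
def FixedPointIsSolution : Prop :=
  ∀ ν : ℝ, 0 < ν → ∀ u₀ : R3 → R3, IsDatum u₀ → ∀ w : FSide,
    WeightedSmooth ν w → IsFixedPoint ν u₀ w → clayR3.Solvable ν 0 u₀

/-- **What §6 delivers (derived): the small-data statement.** For `ν > (2C/π)‖max{1,|ξ|}² û⁰‖_{L¹⊕L²}`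
the datum `u⁰` has a Clay-sense solution at viscosity `ν` (Steps 4 ∧ 5 ∧ 6, `smallData_of_steps`).
(Orientation for the salvage seat, not used here: `‖|ξ|^{1/2}û⁰‖_{L²} ≤ ‖max{1,|ξ|}² û⁰‖_{L²}`, so the
hypothesis implies Fujita–Kato smallness up to constants; the paper's own v4 §8 l.2888 ff. reads its
result as small-data.) [cite: VasquezCampos2024, Cor. 23 (`vfastdecrease`) l.2279–2316 p.27; Cor. 24 l.2364–2371 p.28] -/
def SmallData (C : ℝ) : Prop :=
  ∀ ν : ℝ, 0 < ν → ∀ u₀ : R3 → R3, IsDatum u₀ → threshold C u₀ < ν → clayR3.Solvable ν 0 u₀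

/-- **v4's analogue of Step 2** (v4 only; between v4 Thm. 1 l.553–557 and v4's Cor. `vfastdecrease`):
the printed HOMOGENEOUS smallness `‖|ξ|² û⁰‖_{1⊕2} < Cν` must yield the proof's INHOMOGENEOUS threshold
`(2C'/π)‖max{1,|ξ|}² û⁰‖_{1⊕2} < ν` (v4 l.2177–2180). Not printed. [cite: VasquezCampos2024, v4 Thm. 1 l.553–557 (v4 p.2) with v4 l.2177–2180] -/
def GlueV4 (C C' : ℝ) : Prop :=
  ∀ ν : ℝ, 0 < ν → ∀ u₀ : R3 → R3, IsDatum u₀ →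
    (eLpNorm (fun ξ => ‖ξ‖ ^ (2 : ℝ) * ‖hat u₀ ξ‖) 1 volume).toReal +
        (eLpNorm (fun ξ => ‖ξ‖ ^ (2 : ℝ) * ‖hat u₀ ξ‖) 2 volume).toReal < C * ν →
      threshold C' u₀ < ν

/-! ## Compositions (pure logic; nothing above is asserted) -/

/-- Steps 4, 5, 6 compose to the small-data statement (§6 as a whole).
[cite: VasquezCampos2024, §6 l.2003–2423 pp.23–29] -/
theorem smallData_of_steps {C : ℝ} (h4 : IterateBounds C) (h5 : SeriesConvergence C)
    (h6 : FixedPointIsSolution) : SmallData C := by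
  intro ν hν u₀ hu₀ hthr
  obtain ⟨v, w, _, _, hws, hfix⟩ := h5 ν hν u₀ hu₀ (fun v hv => h4 ν hν u₀ hu₀ v hv) hthr
  exact h6 ν hν u₀ hu₀ w hws hfix

/-- A rescaled datum is again a datum (smooth, divergence-free, rapidly decaying): bookkeeping used by
the composition exactly where l.713 says «Since `v⁰ ∈ S(ℝ^d)^d` if `u ∈ S(ℝ^d)^d`».
[cite: VasquezCampos2024, §2 l.713 p.5] -/
theorem isDatum_rescale {u₀ : R3 → R3} (hu₀ : IsDatum u₀) {α : ℝ} (hα : 0 < α) :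
    IsDatum (fun x => u₀ (α⁻¹ • x)) := by
  obtain ⟨hs, hdiv, hdec⟩ := hu₀
  have hlin : ContDiff ℝ ∞ (fun x : R3 => α⁻¹ • x) := contDiff_const_smul α⁻¹
  refine ⟨hs.comp hlin, ?_, ?_⟩
  · -- divergence of `x ↦ u₀(α⁻¹ x)` is `α⁻¹ (div u₀)(α⁻¹ x) = 0` (Mathlib `fderiv_comp_smul`)
    intro x
    have hx := hdiv (α⁻¹ • x)
    simp only [NSWave0.divergence] at hx ⊢
    rw [fderiv_comp_smul, ContinuousLinearMap.toLinearMap_smul, map_smul, hx, smul_zero]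
  · -- rapid decay: `‖Dⁿ(u₀ ∘ α⁻¹•)(x)‖ = α⁻ⁿ ‖Dⁿu₀(α⁻¹x)‖` and `(1+‖x‖) ≤ max{1,α}(1+‖α⁻¹x‖)`
    intro n K
    obtain ⟨C₀, hC₀⟩ := hdec n K
    have hαinv : 0 < α⁻¹ := inv_pos.mpr hα
    refine ⟨max 1 α ^ K * (‖α⁻¹‖ ^ n * max C₀ 0), fun x => ?_⟩
    -- the derivative of the composition with the linear map `α⁻¹ • id`
    have hder : ‖iteratedFDeriv ℝ n (fun y : R3 => u₀ (α⁻¹ • y)) x‖ ≤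
        ‖α⁻¹‖ ^ n * ‖iteratedFDeriv ℝ n u₀ (α⁻¹ • x)‖ := by
      have key := ContinuousLinearMap.iteratedFDeriv_comp_right (α⁻¹ • ContinuousLinearMap.id ℝ R3)
        hs x (i := n) (by exact_mod_cast le_top)
      have hfun : (u₀ ∘ ⇑(α⁻¹ • ContinuousLinearMap.id ℝ R3)) = fun y : R3 => u₀ (α⁻¹ • y) := by
        funext y; simp
      have hxeq : (α⁻¹ • ContinuousLinearMap.id ℝ R3) x = α⁻¹ • x := by simp
      rw [hfun, hxeq] at key
      rw [key]
      refine (ContinuousMultilinearMap.norm_compContinuousLinearMap_le _ _).trans ?_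
      simp only [Finset.prod_const, Finset.card_univ, Fintype.card_fin]
      have hnorm : ‖α⁻¹ • ContinuousLinearMap.id ℝ R3‖ ≤ ‖α⁻¹‖ := by
        rw [norm_smul]
        exact mul_le_of_le_one_right (norm_nonneg _) ContinuousLinearMap.norm_id_le
      rw [mul_comm]
      gcongr
    have hx : (1 + ‖x‖) ≤ max 1 α * (1 + ‖α⁻¹ • x‖) := by
      rw [norm_smul, norm_inv, Real.norm_eq_abs, abs_of_pos hα]
      have hm1 : (1 : ℝ) ≤ max 1 α := le_max_left _ _
      have hmα : α ≤ max 1 α := le_max_right _ _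
      have : ‖x‖ = α * (α⁻¹ * ‖x‖) := by field_simp
      nlinarith [norm_nonneg x, mul_nonneg (le_max_left (1:ℝ) α |>.trans' zero_le_one) (by positivity : (0:ℝ) ≤ α⁻¹ * ‖x‖)]
    have hxK : (1 + ‖x‖) ^ K ≤ (max 1 α) ^ K * (1 + ‖α⁻¹ • x‖) ^ K := by
      rw [← mul_pow]; exact pow_le_pow_left₀ (by positivity) hx K
    have hCx := hC₀ (α⁻¹ • x)
    calc (1 + ‖x‖) ^ K * ‖iteratedFDeriv ℝ n (fun y : R3 => u₀ (α⁻¹ • y)) x‖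
        ≤ ((max 1 α) ^ K * (1 + ‖α⁻¹ • x‖) ^ K) * (‖α⁻¹‖ ^ n * ‖iteratedFDeriv ℝ n u₀ (α⁻¹ • x)‖) :=
          mul_le_mul hxK hder (norm_nonneg _) (by positivity)
      _ = (max 1 α) ^ K * ‖α⁻¹‖ ^ n * ((1 + ‖α⁻¹ • x‖) ^ K * ‖iteratedFDeriv ℝ n u₀ (α⁻¹ • x)‖) := by
          ring
      _ ≤ (max 1 α) ^ K * ‖α⁻¹‖ ^ n * max C₀ 0 := by
          gcongr
          exact hCx.trans (le_max_left _ _)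
      _ = max 1 α ^ K * (‖α⁻¹‖ ^ n * max C₀ 0) := by ring

/-- **COMPOSITION** (the paper's logic, through the implicit Step 2): given `ν > 0` and a datum `u⁰`,
Step 2 supplies `α > 0` with `(αν, u⁰(·/α))` above the threshold; §6 (Steps 4–6, `SmallData`) solves the
rescaled problem; Step 1 scales back. [cite: VasquezCampos2024, §2 l.713–733 p.5 with §6 l.2279–2423 pp.27–29] -/
theorem claim_of_steps {C : ℝ} (h1 : Reduction) (h2 : GlueThreshold C) (h4 : IterateBounds C)
    (h5 : SeriesConvergence C) (h6 : FixedPointIsSolution) : ClaimedTheorem := by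
  intro ν hν u₀ hs hdiv hdec
  have hu₀ : IsDatum u₀ := ⟨hs, hdiv, hdec⟩
  obtain ⟨α, hα, hthr⟩ := h2 ν hν u₀ hu₀
  have hsmall := smallData_of_steps h4 h5 h6 (α * ν) (mul_pos hα hν) _ (isDatum_rescale hu₀ hα) hthr
  exact h1 ν α hν hα u₀ hu₀ hsmall

/-- Undoing a rescaling: `(w(·/α))(·/α⁻¹) = w` (private plumbing for `claim_of_steps_abs`). [folklore] -/
private theorem rescale_rescale_inv (w : R3 → R3) {α : ℝ} (hα : α ≠ 0) :
    (fun x => (fun y => w (α⁻¹ • y)) (α⁻¹⁻¹ • x)) = w := by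
  funext x
  simp [smul_smul, inv_mul_cancel₀ hα]

/-- **COMPOSITION AT THE ABSTRACT GRAIN** (the paper's logic through `CompositionRule` instead of the
concrete `GlueThreshold`): instantiate the rule with `W = (ℝ³ → ℝ³)`, `scale α w = w(·/α)`,
`P w ν := 0 < ν → IsDatum w → clayR3.Solvable ν 0 w` (viscosities are positive throughout the paper,
§2 l.657 p.4); its first hypothesis is `SmallData C` (Steps 4–6) with `ν₀ = max (threshold C w) 0`, its
second is the §2 reduction (Step 1, in both directions via `α` and `α⁻¹`).
[cite: VasquezCampos2024, §2 l.713–733 p.5 with §6 l.2279–2423 pp.27–29] -/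
theorem claim_of_steps_abs {C : ℝ} (h1 : Reduction) (h2 : CompositionRule) (h4 : IterateBounds C)
    (h5 : SeriesConvergence C) (h6 : FixedPointIsSolution) : ClaimedTheorem := by
  have hsmall := smallData_of_steps h4 h5 h6
  intro ν hν u₀ hs hdiv hdec
  refine h2 (R3 → R3) (fun α w => fun x => w (α⁻¹ • x))
    (fun w μ => 0 < μ → IsDatum w → clayR3.Solvable μ 0 w) ?_ ?_ u₀ ν hν hν ⟨hs, hdiv, hdec⟩
  · -- threshold existence per datum: §6 (`SmallData`)
    intro w
    refine ⟨max (threshold C w) 0, fun μ hμ hμpos hw => ?_⟩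
    exact hsmall μ hμpos w hw (lt_of_le_of_lt (le_max_left _ _) hμ)
  · -- scaling equivalence: §2 (Step 1) in both directions
    intro w μ α hα
    constructor
    · intro h hαμ hw'
      have hμ : 0 < μ := pos_of_mul_pos_right hαμ hα.le
      have hw : IsDatum w := by
        have := isDatum_rescale hw' (inv_pos.mpr hα)
        rwa [rescale_rescale_inv w hα.ne'] at this
      refine h1 (α * μ) α⁻¹ hαμ (inv_pos.mpr hα) _ hw' ?_
      rw [rescale_rescale_inv w hα.ne', ← mul_assoc, inv_mul_cancel₀ hα.ne', one_mul]
      exact h hμ hw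
    · intro h hμ hw
      exact h1 μ α hμ hα w hw (h (mul_pos hα hμ) (isDatum_rescale hw hα))

/-- **Clay link**: the claimed statement IS Clay (A) in the `ClayVariants` schema (identity).
[cite: VasquezCampos2024, Introduction l.501 p.2] -/
theorem clay_of_claimed (h : ClaimedTheorem) : clayR3.Regularity :=
  fun ν hν u₀ hu₀ hdiv hdec => h ν hν u₀ hu₀ hdiv hdec

/-- Conversely Clay (A) is the claimed statement (so no Clay delta either way).
[cite: VasquezCampos2024, Introduction l.501 p.2] -/
theorem claimed_of_clay (h : clayR3.Regularity) : ClaimedTheorem :=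
  fun ν hν u₀ hu₀ hdiv hdec => h ν hν u₀ hu₀ hdiv hdec

/-- v4's composition (secondary): the printed v4 Theorem 1 follows from what §6 delivers only through
`GlueV4`. [cite: VasquezCampos2024, v4 Thm. 1 l.553–557 (v4 p.2); v4 §6] -/
theorem claimedV4_of_steps {C C' : ℝ} (hC : 0 < C) (hg : GlueV4 C C') (hs : SmallData C') :
    ClaimedTheoremV4 :=
  ⟨C, hC, fun ν hν u₀ hu₀ hsmall => hs ν hν u₀ hu₀ (hg ν hν u₀ hu₀ hsmall)⟩


/-! ## Step 1 (`Reduction`) discharged: Leray's rescaling followed by the amplitude–time rescaling -/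

/-- Haar change of variables on `ℝ³` for lower integrals: `∫⁻ g(a • x) dx = |(a³)⁻¹| ∫⁻ g` for `a ≠ 0`
(Mathlib `Measure.map_addHaar_smul`). [folklore] -/
private theorem lintegral_comp_smul_R3 (g : R3 → ℝ≥0∞) {a : ℝ} (ha : a ≠ 0) :
    ∫⁻ x, g (a • x) = ENNReal.ofReal |(a ^ Module.finrank ℝ R3)⁻¹| * ∫⁻ x, g x := by
  calc ∫⁻ x, g (a • x) = ∫⁻ y, g y ∂(Measure.map (a • ·) volume) :=
        (lintegral_map_equiv g (Homeomorph.smul (isUnit_iff_ne_zero.2 ha).unit).toMeasurableEquiv).symm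
    _ = ENNReal.ofReal |(a ^ Module.finrank ℝ R3)⁻¹| * ∫⁻ x, g x := by
        rw [Measure.map_addHaar_smul volume ha, lintegral_smul_measure, smul_eq_mul]

/-- Bounded energy (Fefferman's (7)) is preserved by Leray's rescaling `v ↦ c v(c²t, cx)`, `c > 0`
(the bound is multiplied by `c² · c⁻³`). [folklore] -/
private theorem hasBoundedEnergy_nsRescale {v : ℝ → R3 → R3} (hE : HasBoundedEnergy v) {c : ℝ}
    (hc : 0 < c) : HasBoundedEnergy (nsRescale c v) := by
  obtain ⟨C, hC, hCb⟩ := hE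
  refine ⟨ENNReal.ofReal (c ^ 2) * (ENNReal.ofReal |(c ^ Module.finrank ℝ R3)⁻¹| * C),
    ENNReal.mul_lt_top ENNReal.ofReal_lt_top (ENNReal.mul_lt_top ENNReal.ofReal_lt_top hC),
    fun t ht => ?_⟩
  have h1 : (fun x => ‖nsRescale c v t x‖ₑ ^ 2) = fun x => ‖c • v (c ^ 2 * t) (c • x)‖ₑ ^ 2 := by
    funext x; rfl
  rw [h1, lintegral_enorm_sq_const_smul,
    lintegral_comp_smul_R3 (fun y => ‖v (c ^ 2 * t) y‖ₑ ^ 2) hc.ne']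
  gcongr
  exact hCb (c ^ 2 * t) (by positivity)

/-- **Step 1 (`Reduction`, §2 l.660–733 pp.4–5) HOLDS (kernel)**: solvability of the Clay problem at
viscosity `αν` for the datum `u⁰(·/α)` gives solvability at viscosity `ν` for `u⁰` — Leray's parabolic
rescaling by `α` (datum becomes `α u⁰`, same viscosity, bounded energy kept; `isNavierStokesSolution_nsRescale_zero`)
followed by the amplitude–time rescaling by `α⁻¹` (datum `u⁰`, viscosity `ν`; `ClaySpec.Solvable.of_viscosity`);
the composite is the paper's `u(x,t) = v(αx, αt)` (Leray 1934 §20 symmetry bookkeeping — the claim fails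
at the NEXT step, the threshold not being scale-invariant). The same statement is independently
kernel-certified Summits-side by the salvage lane
(`Summit.NavierStokesRegularity.NavierStokesRegularity.Theorems.VasquezCampos2024.reduction_holds` in
`SoloSalvageVasquezCampos2024.lean`, whose proof this discharge follows); it is re-proved here, where the
fact is declared, because Literature cannot import Summits. No statement of the file is modified.
[cite: VasquezCampos2024, §2 l.660–733 pp.4–5] -/
theorem reduction_holds : Reduction := by
  intro ν α _hν hα u₀ _hu₀ hsol
  obtain ⟨v, q, hv, hq, hns, hE⟩ := hsol
  -- Leray rescaling by `c = α`
  obtain ⟨hns', hv', hq'⟩ := isNavierStokesSolution_nsRescale_zero hns hv hq hα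
  have hdat : nsRescaleData α (fun x : R3 => u₀ (α⁻¹ • x)) = fun x => (α⁻¹)⁻¹ • u₀ x := by
    funext x
    simp [nsRescaleData, smul_smul, inv_mul_cancel₀ hα.ne']
  rw [hdat] at hns'
  have hsol' : clayR3.Solvable (α * ν) 0 (fun x => (α⁻¹)⁻¹ • u₀ x) :=
    ⟨_, _, hv', hq', hns', hasBoundedEnergy_nsRescale hE hα⟩
  -- amplitude–time rescaling by `a = α⁻¹`
  have h2 := ClaySpec.Solvable.of_viscosity (S := clayR3) (μ := α * ν) (a := α⁻¹) (inv_pos.2 hα)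
    (fun w _ hw => hasBoundedEnergy_timeRescale hw (inv_pos.2 hα)) (g := 0) hsol'
  have hvis : α⁻¹ * (α * ν) = ν := by field_simp
  have hforce : timeRescale α⁻¹ (α⁻¹ ^ 2) (0 : ℝ → R3 → R3) = 0 := by
    funext s x; simp [timeRescale]
  rw [hvis, hforce] at h2
  exact h2

end

end Literature.Claims.NS.VasquezCampos2024
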